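import Summits.NavierStokesRegularity.NavierStokesRegularity.Theorems.GaldiLiouvilleGateRecordZoomAncientStubZoomBound
import Summits.NavierStokesRegularity.NavierStokesRegularity.Theorems.GaldiLiouvilleGateRecordZoomAncientStubZoomLimit
import Literature.Analysis.FluidPDE.BoundedL2ClassicalMild
import Literature.Analysis.FluidPDE.NSBoundedMildOseen
import HarnessLib

/-!
# Route `GaldiLiouvilleGate`, crux `RecordZoomAncient` (stmt-NavierStokesRegularity-0894),
  line `registered` (birth skeleton, reshape r4) — stub `stub_zoomC1kappa`
  (rescaling wrapper: uniform `C^{1,κ}` regularity after three critical time units)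

**Statement.** Assume (i) the quantitative `C^{1,κ}` theory of bounded Oseen-mild fields: for
every `m ≥ 0` there are `C₁, H, κ > 0` such that a field `z`, jointly continuous and bounded by
`m` on `[a, b] × ℝ³` and satisfying `z(t) = e^{(t-s)Δ} z(s) - B¹_s(z, z)(t)` for `a ≤ s < t ≤ b`,
has `|∇z(t)| ≤ C₁` and `[∇z(t)]_κ ≤ H` for `t ∈ [a + 2, b]`; and (ii) the universal velocity bound
`‖u(t, x)‖ ≤ C L/ν` on `[ν³/L², tc]` for classical Leray–Hopf Tao-class solutions with enstrophy
`≤ L` on `[0, tc]`. Then there are UNIVERSAL `C₁, H, κ > 0` with: for every such solution and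
every `t ∈ [3ν³/L², tc]`, `‖∇u(t, x)‖ ≤ C₁ L²/ν³` and
`‖∇u(t, x) - ∇u(t, x')‖ ≤ H (L²/ν³) (L ‖x - x'‖/ν²)^κ`.

**Proof.** Take `C₁, H, κ` from (i) with `m = max C 0`. Put `α = ν/L`, `γ = ν²/L`,
`β = α γ = ν³/L²` and zoom from time `0`: `z = α • stPull β γ 0 0 u`, `z(s, y) = α u(β s, γ y)`.
The zoom is a classical solution with viscosity `α ν/γ = 1` on `(0, T/β)`
(`IsClassicalNSSolutionOn.stRescale`); on `(0, T₀]`, `T₀ = (tc + T)/(2β)`, it is bounded (the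
Tao-class representation on `[0, (tc + T)/2]`, `IsTaoSolutionOn.exists_bound_velocity`) with
uniformly `L²`-bounded slices (Leray–Hopf energy bound `IsLerayHopfOn.lintegral_enorm_sq_le` and
the change of variables `eLpNorm_comp_space_affine`), hence Oseen-mild for `0 < s < t < T₀`
(`mild_of_bounded_of_eLpNorm_two_le_of_lt`, KNSS 2009 Lemma 3.1 + finite energy). On the slab
`[1, s_c]`, `s_c = tc/β < T₀`, the zoom is bounded by `α · C L/ν = C ≤ m` (hypothesis (ii) read in
zoom units), so (i) gives `|∇z(s)| ≤ C₁`, `[∇z(s)]_κ ≤ H` for `s ∈ [3, s_c]`. Undo the scaling: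
`∇z(s)(y) = (α γ) ∇u(β s)(γ y) = β ∇u(t)(x)` (`fderiv_zoom_slice`) with `t = β s ∈ [3β, tc]`,
`x = γ y`, and `γ⁻¹ = L/ν²`, `β⁻¹ = L²/ν³`.

Sources: G. Koch, N. Nadirashvili, G. Seregin, V. Šverák, Acta Math. 203 (2009), Lemma 3.1,
Prop. 4.1, §6 (6.2); J. Leray, Acta Math. 63 (1934), §20 (similarity).
-/

noncomputable section

open Set MeasureTheory Filter Topology Function Metric
open scoped ENNReal NNReal
open Literature.Analysis.FluidPDE

namespace Summit.NavierStokesRegularity.NavierStokesRegularity.Theorems.RecordZoomAncient.Birth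

-- the problem-side namespace `Summit.NavierStokesRegularity.NavierStokesRegularity.…` (summit =
-- problem for this single-problem summit) duplicates `NavierStokesRegularity` by design
set_option linter.dupNamespace false

/-- **stub 3a' — `stub_zoomC1kappa` (rescaling wrapper: uniform `C^{1,κ}` regularity of the
enstrophy-normalised solution after three critical time units; statement and proof in the module
docstring).** -/
theorem stub_zoomC1kappa :
    (∀ m : ℝ, 0 ≤ m → ∃ C₁ H κ : ℝ, 0 < κ ∧
      ∀ (z : ℝ → EuclideanSpace ℝ (Fin 3) → EuclideanSpace ℝ (Fin 3)) (a b : ℝ),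
        ContinuousOn (Function.uncurry z) (Set.Icc a b ×ˢ Set.univ) →
        (∀ t ∈ Set.Icc a b, ∀ x, ‖z t x‖ ≤ m) →
        (∀ s t : ℝ, a ≤ s → s < t → t ≤ b → ∀ x,
          z t x = Literature.Analysis.UnboundedOperators.heatExtension (z s) (t - s) x - oseenDuhamel 1 s z z t x) →
        ∀ t ∈ Set.Icc (a + 2) b,
          (∀ x, ‖fderiv ℝ (z t) x‖ ≤ C₁) ∧
          (∀ x x', ‖fderiv ℝ (z t) x - fderiv ℝ (z t) x'‖ ≤ H * ‖x - x'‖ ^ κ)) →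
    ∀ C : ℝ, (∀ (ν T : ℝ), 0 < ν → 0 < T →
      ∀ (u : ℝ → EuclideanSpace ℝ (Fin 3) → EuclideanSpace ℝ (Fin 3)) (p : ℝ → EuclideanSpace ℝ (Fin 3) → ℝ),
        IsClassicalNSSolutionOn (Set.Ico 0 T) ν 0 u p → IsLerayHopfOn T ν 0 (u 0) u →
        HasRapidSpatialDecay (u 0) →
        (∀ T' ∈ Set.Ioo 0 T, ∃ P : ℝ → EuclideanSpace ℝ (Fin 3) → ℝ, IsTaoSolutionOn T' ν (u 0) u P) →
        ∀ (tc L : ℝ), 0 < tc → tc < T → 0 < L →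
          (∀ t ∈ Set.Icc 0 tc,
            ∫⁻ x, ENNReal.ofReal (frobeniusNormSq (fderiv ℝ (u t) x)) ≤ ENNReal.ofReal L) →
          ∀ t ∈ Set.Icc (ν ^ 3 / L ^ 2) tc, ∀ x, ‖u t x‖ ≤ C * L / ν) →
    ∃ C₁ H κ : ℝ, 0 < κ ∧ ∀ (ν T : ℝ), 0 < ν → 0 < T →
      ∀ (u : ℝ → EuclideanSpace ℝ (Fin 3) → EuclideanSpace ℝ (Fin 3)) (p : ℝ → EuclideanSpace ℝ (Fin 3) → ℝ),
        IsClassicalNSSolutionOn (Set.Ico 0 T) ν 0 u p → IsLerayHopfOn T ν 0 (u 0) u →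
        HasRapidSpatialDecay (u 0) →
        (∀ T' ∈ Set.Ioo 0 T, ∃ P : ℝ → EuclideanSpace ℝ (Fin 3) → ℝ, IsTaoSolutionOn T' ν (u 0) u P) →
        ∀ (tc L : ℝ), 0 < tc → tc < T → 0 < L →
          (∀ t ∈ Set.Icc 0 tc,
            ∫⁻ x, ENNReal.ofReal (frobeniusNormSq (fderiv ℝ (u t) x)) ≤ ENNReal.ofReal L) →
          ∀ t ∈ Set.Icc (3 * ν ^ 3 / L ^ 2) tc,
            (∀ x, ‖fderiv ℝ (u t) x‖ ≤ C₁ * L ^ 2 / ν ^ 3) ∧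
            (∀ x x', ‖fderiv ℝ (u t) x - fderiv ℝ (u t) x'‖ ≤
              H * (L ^ 2 / ν ^ 3) * (L / ν ^ 2 * ‖x - x'‖) ^ κ) := by
  intro hOSEEN C hZB
  obtain ⟨C₁, H, κ, hκ, hO⟩ := hOSEEN (max C 0) (le_max_right _ _)
  refine ⟨C₁, H, κ, hκ, ?_⟩
  intro ν T hν hT u p hcl hLH hdec hrep tc L htc htcT hL hE
  -- ### scales `α = ν/L`, `γ = ν²/L`, `β = α γ = ν³/L²` (viscosity `α ν/γ = 1`)
  have hν0 : ν ≠ 0 := hν.ne'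
  have hL0 : L ≠ 0 := hL.ne'
  obtain ⟨α, hα_def⟩ : ∃ α : ℝ, α = ν / L := ⟨_, rfl⟩
  obtain ⟨γ, hγ_def⟩ : ∃ γ : ℝ, γ = ν ^ 2 / L := ⟨_, rfl⟩
  obtain ⟨β, hβ_def⟩ : ∃ β : ℝ, β = ν ^ 3 / L ^ 2 := ⟨_, rfl⟩
  have hα : 0 < α := by rw [hα_def]; positivity
  have hγ : 0 < γ := by rw [hγ_def]; positivity
  have hβ : 0 < β := by rw [hβ_def]; positivity
  have hβ0 : β ≠ 0 := hβ.ne'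
  have hγ0 : γ ≠ 0 := hγ.ne'
  have hβαγ : β = α * γ := by rw [hα_def, hγ_def, hβ_def]; field_simp
  have hvisc : α * ν / γ = 1 := by rw [hα_def, hγ_def]; field_simp
  have hαC : α * (C * L / ν) = C := by rw [hα_def]; field_simp
  have hL2ν3 : L ^ 2 / ν ^ 3 = β⁻¹ := by rw [hβ_def, inv_div]
  have hγinv : γ⁻¹ = L / ν ^ 2 := by rw [hγ_def, inv_div]
  -- ### the zoom from time `0`: `z (s, y) = α u(β s, γ y)`
  obtain ⟨z, hz⟩ : ∃ z : ℝ → EuclideanSpace ℝ (Fin 3) → EuclideanSpace ℝ (Fin 3),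
      z = α • stPull β γ 0 0 u := ⟨_, rfl⟩
  have hzs : ∀ r, z r = α • fun y => u (0 + β * r) (0 + γ • y) := fun r => by rw [hz]; rfl
  have hzn : ∀ r y, ‖z r y‖ = α * ‖u (0 + β * r) (0 + γ • y)‖ := fun r y => by
    rw [hz]
    simp only [Pi.smul_apply, stPull_apply, norm_smul, Real.norm_of_nonneg hα.le]
  have hDz : ∀ r y, fderiv ℝ (z r) y = (α * γ) • fderiv ℝ (u (0 + β * r)) (γ • y) :=
    fun r y => by rw [hz]; exact fderiv_zoom_slice α β γ 0 u r y
  -- ### rescaled horizons: `Tz = T/β` (classical), `T₀ = (tc + T)/(2β)` (bounded), `sc = tc/β`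
  obtain ⟨Tz, hTz⟩ : ∃ Tz : ℝ, Tz = T / β := ⟨_, rfl⟩
  obtain ⟨T₀, hT₀⟩ : ∃ T₀ : ℝ, T₀ = (tc + T) / 2 / β := ⟨_, rfl⟩
  obtain ⟨sc, hsc⟩ : ∃ sc : ℝ, sc = tc / β := ⟨_, rfl⟩
  have hβsc : β * sc = tc := by rw [hsc]; field_simp
  have hβT₀ : β * T₀ = (tc + T) / 2 := by rw [hT₀]; field_simp
  have hβTz : β * Tz = T := by rw [hTz]; field_simp
  have hsc0 : 0 < sc := by rw [hsc]; positivity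
  have hscT₀ : sc < T₀ := by
    rw [hsc, hT₀]; exact div_lt_div_of_pos_right (by linarith) hβ
  have hT₀Tz : T₀ < Tz := by
    rw [hT₀, hTz]; exact div_lt_div_of_pos_right (by linarith) hβ
  have hT₀0 : 0 < T₀ := hsc0.trans hscT₀
  have hmid : (tc + T) / 2 ≤ T := by linarith
  -- original times of rescaled times
  have horig : ∀ r, 0 < r → r < Tz → 0 + β * r ∈ Ico 0 T := fun r h1 h2 =>
    ⟨by rw [zero_add]; exact (mul_pos hβ h1).le,
      by rw [zero_add, ← hβTz]; exact mul_lt_mul_of_pos_left h2 hβ⟩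
  have horig₀ : ∀ r ∈ Ioc 0 T₀, 0 + β * r ∈ Icc 0 ((tc + T) / 2) := fun r hr =>
    ⟨by rw [zero_add]; exact (mul_pos hβ hr.1).le,
      by rw [zero_add, ← hβT₀]; exact mul_le_mul_of_nonneg_left hr.2 hβ.le⟩
  -- ### the zoom is a classical solution with viscosity `1` on `(0, Tz)`
  have hclz : IsClassicalNSSolutionOn (Ioo 0 Tz) 1 0 z (α ^ 2 • stPull β γ 0 0 p) := by
    have h := hcl.stRescale hα hγ hβαγ 0 0
    rw [smul_stPull_zero, hvisc, ← hz] at h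
    exact h.mono (fun r hr => horig r hr.1 hr.2) (uniqueDiffOn_Ioo _ _)
  -- ### boundedness of the zoom on `(0, T₀]` (Tao class on `[0, (tc + T)/2]`)
  have hT₁ : (tc + T) / 2 ∈ Ioo 0 T := ⟨by linarith, by linarith⟩
  obtain ⟨P, hP⟩ := hrep _ hT₁
  obtain ⟨B, -, hB⟩ := hP.exists_bound_velocity
  have hbz : ∀ r ∈ Ioc 0 T₀, ∀ y, ‖z r y‖ ≤ α * B := fun r hr y => by
    rw [hzn]
    exact mul_le_mul_of_nonneg_left (hB _ (horig₀ r hr) _) hα.le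
  -- ### uniform `L²` bound of the zoom slices on `(0, T₀]` (Leray–Hopf energy bound)
  obtain ⟨E2, hE2top, hE2⟩ :
      ∃ E2 : ℝ≥0∞, E2 ≠ ∞ ∧ ∀ t ∈ Icc 0 T, eLpNorm (u t) 2 volume ≤ E2 := by
    refine ⟨ENNReal.ofReal (Real.sqrt (2 * VectorCalculus.kineticEnergy (u 0))),
      ENNReal.ofReal_ne_top, fun t ht => (ENNReal.pow_le_pow_left_iff two_ne_zero).1 ?_⟩
    rw [eLpNorm_two_sq_eq_lintegral, ← ENNReal.ofReal_pow (Real.sqrt_nonneg _),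
      Real.sq_sqrt (mul_nonneg zero_le_two (kineticEnergy_nonneg _))]
    exact hLH.lintegral_enorm_sq_le hν.le ht
  obtain ⟨K, hKtop, hK⟩ : ∃ K : ℝ≥0∞, K ≠ ∞ ∧ ∀ r ∈ Ioc 0 T₀, eLpNorm (z r) 2 volume ≤ K := by
    refine ⟨‖α‖ₑ *
      (ENNReal.ofReal (γ ^ Module.finrank ℝ (EuclideanSpace ℝ (Fin 3)))⁻¹ ^
        (1 / (2 : ℝ≥0∞)).toReal * E2), ?_, fun r hr => ?_⟩
    · exact ENNReal.mul_ne_top enorm_ne_top (ENNReal.mul_ne_top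
        (ENNReal.rpow_ne_top_of_nonneg ENNReal.toReal_nonneg ENNReal.ofReal_ne_top) hE2top)
    · rw [hzs r, eLpNorm_const_smul, eLpNorm_comp_space_affine hγ 0 _ 2]
      gcongr
      exact hE2 _ ⟨(horig₀ r hr).1, (horig₀ r hr).2.trans hmid⟩
  -- ### the Oseen identity of the zoom (KNSS 2009, Lemma 3.1 + finite energy)
  have hmildz : ∀ s t : ℝ, 1 ≤ s → s < t → t ≤ sc → ∀ x,
      z t x = Literature.Analysis.UnboundedOperators.heatExtension (z s) (t - s) x -
        oseenDuhamel 1 s z z t x :=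
    fun s t hs hst ht x => mild_of_bounded_of_eLpNorm_two_le_of_lt hclz hT₀0 hT₀Tz hbz hKtop hK
      (zero_lt_one.trans_le hs) hst (ht.trans_lt hscT₀) x
  -- ### joint continuity and the universal bound on the slab `[1, sc]`
  have hsub : Icc 1 sc ⊆ Ioo 0 Tz := fun r hr =>
    ⟨zero_lt_one.trans_le hr.1, hr.2.trans_lt (hscT₀.trans hT₀Tz)⟩
  have hcont : ContinuousOn (uncurry z) (Icc 1 sc ×ˢ univ) :=
    hclz.smooth_velocity.continuousOn.mono (prod_mono hsub Subset.rfl)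
  have hbdd : ∀ r ∈ Icc 1 sc, ∀ y, ‖z r y‖ ≤ max C 0 := fun r hr y => by
    rw [hzn]
    have hmem : 0 + β * r ∈ Icc (ν ^ 3 / L ^ 2) tc := by
      rw [← hβ_def, zero_add]
      exact ⟨le_mul_of_one_le_right hβ.le hr.1,
        (mul_le_mul_of_nonneg_left hr.2 hβ.le).trans_eq hβsc⟩
    calc α * ‖u (0 + β * r) (0 + γ • y)‖ ≤ α * (C * L / ν) :=
          mul_le_mul_of_nonneg_left
            (hZB ν T hν hT u p hcl hLH hdec hrep tc L htc htcT hL hE _ hmem _) hα.le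
      _ = C := hαC
      _ ≤ max C 0 := le_max_left _ _
  -- ### the `C^{1,κ}` regularity of the zoom on `[3, sc]`
  have hreg := hO z 1 sc hcont hbdd hmildz
  -- ### undo the scaling
  intro t ht
  obtain ⟨ht1, ht2⟩ := ht
  have e3 : 3 * ν ^ 3 / L ^ 2 = (1 + 2) * β := by rw [hβ_def]; ring
  rw [e3] at ht1
  have hs : t / β ∈ Icc (1 + 2) sc :=
    ⟨(le_div_iff₀ hβ).2 ht1, by rw [hsc]; exact div_le_div_of_nonneg_right ht2 hβ.le⟩
  obtain ⟨hg, hh⟩ := hreg (t / β) hs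
  have et : 0 + β * (t / β) = t := by rw [zero_add]; field_simp
  have ex : ∀ x : EuclideanSpace ℝ (Fin 3), γ • γ⁻¹ • x = x := fun x => by
    rw [smul_smul, mul_inv_cancel₀ hγ0, one_smul]
  have hD : ∀ x, fderiv ℝ (z (t / β)) (γ⁻¹ • x) = β • fderiv ℝ (u t) x := fun x => by
    rw [hDz, et, ex, ← hβαγ]
  refine ⟨fun x => ?_, fun x x' => ?_⟩
  · have h1 := hg (γ⁻¹ • x)
    rw [hD, norm_smul, Real.norm_of_nonneg hβ.le] at h1
    calc ‖fderiv ℝ (u t) x‖ = L ^ 2 / ν ^ 3 * (β * ‖fderiv ℝ (u t) x‖) := by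
          rw [hL2ν3, ← mul_assoc, inv_mul_cancel₀ hβ0, one_mul]
      _ ≤ L ^ 2 / ν ^ 3 * C₁ := mul_le_mul_of_nonneg_left h1 (by positivity)
      _ = C₁ * L ^ 2 / ν ^ 3 := by ring
  · have h2 := hh (γ⁻¹ • x) (γ⁻¹ • x')
    have e5 : β • fderiv ℝ (u t) x - β • fderiv ℝ (u t) x' =
        β • (fderiv ℝ (u t) x - fderiv ℝ (u t) x') := (smul_sub β _ _).symm
    rw [hD, hD, e5, ← smul_sub, norm_smul, norm_smul, Real.norm_of_nonneg hβ.le,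
      Real.norm_of_nonneg (inv_nonneg.2 hγ.le), hγinv] at h2
    calc ‖fderiv ℝ (u t) x - fderiv ℝ (u t) x'‖
        = L ^ 2 / ν ^ 3 * (β * ‖fderiv ℝ (u t) x - fderiv ℝ (u t) x'‖) := by
          rw [hL2ν3, ← mul_assoc, inv_mul_cancel₀ hβ0, one_mul]
      _ ≤ L ^ 2 / ν ^ 3 * (H * (L / ν ^ 2 * ‖x - x'‖) ^ κ) :=
          mul_le_mul_of_nonneg_left h2 (by positivity)
      _ = H * (L ^ 2 / ν ^ 3) * (L / ν ^ 2 * ‖x - x'‖) ^ κ := by ring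

end Summit.NavierStokesRegularity.NavierStokesRegularity.Theorems.RecordZoomAncient.Birth

end
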